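import Literature.AlgebraicGeometry.Motives.HodgeStructureLefschetzGroupCenter
import HarnessLib

/-!
# THE CENTRE OF `S(A)` AND ITS INVOLUTION ON `K`-POINTS: `dim_K Z(C(H)(K)) = dim_ℚ C₀` («`Z(C'(A)) = C₀(A) ⊗_k k'`» numerically),
# `†_K` is trivial on `Z(C(H)(K))` iff `†` is trivial on `C₀ = Z(E_φ)` (first kind is insensitive to the coefficient field), and
# then every central element of `S(H)(K)` is an involution (Milne 1999 §1 Remark 1.6, p. 644 L22–L24, p. 645; §2 p. 646)

[topic AlgebraicGeometry/Motives]

Layer `Literature/AlgebraicGeometry/Motives`, lane `lit-hodgefound` (Track 2 foundations library; prover seat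
`lit-hodgefound-p02`, generation 54, self-proposed row g54-#6). THEOREMS ONLY: no definition, no named fact (net debt `0`),
no instance, no notation.  `K`-points companion of g54-#5 (`Motives/HodgeStructureLefschetzGroupCenterByType`) on top of g54-#2
(`Z(C(H)(K)) = span_K {z_K | z ∈ C₀}`, `Motives/HodgeStructureCentralizerSemisimplePoints`) and g54-#4 (`Z(S(H)(K)) = S(H)(K) ∩
(C₀ ⊗ K)`, `Motives/HodgeStructureLefschetzGroupCenter`).  Three statements, for every polarized `ℚ`-Hodge structure on a
finite-dimensional `V` and every field `K ⊇ ℚ` (any universe): (1) the dimension of the centre is stable under extension of the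
coefficient field, `dim_K Z(C(H)(K)) = dim_ℚ Z(E_φ)` — through the general fact that the `K`-span of the base changes of a
rational space `W ⊆ End_ℚ(V)` of endomorphisms has `K`-dimension `dim_ℚ W` (`K` flat over `ℚ` and
`K ⊗ End_ℚ(V) ⥲ End_K(K ⊗ V)`, Bourbaki II §5 no. 3 Prop. 7 (ii); here universe-general, the tree's
`linearIndependent_end_baseChange_of_linearIndependent` having `K` in the universe of `V`); (2) Milne's `K`-adjoint `†_K`
(`Polarization.adjointBaseChange`, `Motives/HodgeStructurePolarizationAdjointPoints`) fixes the centre `Z(C(H)(K))` pointwise iff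
the Rosati involution fixes `C₀ = Z(E_φ)` pointwise — «the subfield of `K` on which the Rosati involutions act trivially» does
not depend on the Weil cohomology ∕ coefficient field (Remark 1.6); (3) in that case (types I–III) every central element `γ` of
`S(H)(K)` satisfies `γ² = 1` (`γ ∈ C₀ ⊗ K` is `†_K`-fixed and `†_K`-unitary).

## The sources, verbatim

* J. S. Milne, *Lefschetz classes on abelian varieties*, Duke Math. J. 96 (1999) 639–675 [Milne1999LefschetzClasses] (held
  `paper:doi-10-1215-s0012-7094-99-09620-5`, folios 4–8): p. 642 L64–L70 ("`β†` the adjoint with respect to `e_D` of a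
  `k`-linear endomorphism `β` of `V(A)`"); p. 644 L16–L24 (`S(A)(R) = {γ ∈ C(A) ⊗_k R | γ†γ = 1}`, «reductive (not necessarily
  connected)»); **Remark 1.6** (p. 644 L29–L34: `C'(A) ≅ C(A) ⊗_k k'`, `S'(A) ≅ S(A)_{/k'}`); p. 645 L1–L6 (`C₀(A)`, «Every
  Rosati involution `†` preserves each factor of `C₀(A)`», `S₀(A)(R) = {γ ∈ C₀(A) ⊗ R | γ†γ = 1}`); §2 p. 646 L10–L16 (`F` = the
  subfield of the centre on which the Rosati involutions act trivially; «`K` equals `F` except when `A` is of type IV»).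
* N. Bourbaki, *Algebra I* [BourbakiAlgebraI1989], Ch. II §5 no. 3 Prop. 7 (ii) (`Hom` commutes with base change for finitely
  generated projective modules); P. Deligne, J. S. Milne, *Tannakian categories* [DeligneMilne1982Tannakian], §1 Prop. 1.9.
* H. Lange (2023) [Lange2023AbelianVarietiesComplex], §2.6.2 Lemma 2.6.4 (first kind = trivial on the centre).

## Dictionary and what is proved (namespace `Literature.AlgebraicGeometry.Motives.HodgeStructure`)

`C(H)(K)`, `S(H)(K) = ψ.lefschetzGroupBaseChange K`, `C₀ = E_φ ⊓ C(H)` (= `Z(E_φ)` pushed into `End_ℚ(V)`), `z_K = z.baseChange K`,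
`†_K = ψ.adjointBaseChange K`, `† = ψ.adjoint`.

* §1 **`finrank_span_image_baseChange_eq`** (`dim_K span_K {w_K | w ∈ W} = dim_ℚ W` for every `ℚ`-subspace `W ⊆ End_ℚ(V)`, any
  field `K ⊇ ℚ` in any universe), **`finrank_center_centralizer_endAlg_baseChange_eq`** (`dim_K Z(C(H)(K)) = dim_ℚ Z(E_φ)`).
* §2 **`Polarization.adjointBaseChange_eq_self_of_mem_span_image_center`** (`†` trivial on `C₀` ⟹ `†_K` trivial on `C₀ ⊗ K`),
  **`Polarization.forall_center_adjointBaseChange_eq_self_iff`** (`†_K` trivial on `Z(C(H)(K))` iff `†` trivial on `Z(E_φ)`).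
* §3 **`Polarization.coe_mul_coe_eq_one_of_mem_center_lefschetzGroupBaseChange`** (first kind ⟹ central elements of `S(H)(K)`
  square to `1`), `Polarization.mul_self_eq_one_of_mem_center_lefschetzGroupBaseChange` (in the group).
-/

noncomputable section

open scoped TensorProduct

namespace Literature.AlgebraicGeometry.Motives

namespace HodgeStructure

universe u uK

variable (K : Type uK) [Field K] [Algebra ℚ K] {V : Type u} [AddCommGroup V] [Module ℚ V] [Module.Finite ℚ V] {n : ℤ}

/-! ## §1 `dim_K span_K {w_K | w ∈ W} = dim_ℚ W`; `dim_K Z(C(H)(K)) = dim_ℚ Z(E_φ)` -/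

omit [Module.Finite ℚ V] in
/-- Mathlib's base-change map of endomorphisms `IsBaseChange.endHom` for `K ⊗_ℚ V` is `a ↦ a_K` (universe-general private copy of
the tree's `endHom_isBaseChange_eq_baseChange`). [cite: BourbakiAlgebraI1989, Ch. II §5 no. 3, formulas (17)–(18)] -/
private theorem endHom_isBaseChange_eq_baseChange₅₄ (a : Module.End ℚ V) :
    (TensorProduct.isBaseChange ℚ V K).endHom a = a.baseChange K := by
  refine LinearMap.ext fun x => ?_
  induction x using TensorProduct.induction_on with
  | zero => rw [map_zero, map_zero]
  | add x y hx hy => rw [map_add, map_add, hx, hy]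
  | tmul c v =>
    have hcv : c ⊗ₜ[ℚ] v = c • ((1 : K) ⊗ₜ[ℚ] v) := by
      rw [TensorProduct.smul_tmul', smul_eq_mul, mul_one]
    rw [hcv, map_smul, map_smul, LinearMap.baseChange_tmul]
    exact congrArg (c • ·) (IsBaseChange.endHom_comp_apply (TensorProduct.isBaseChange ℚ V K) a v)

/-- The base changes of `ℚ`-linearly independent endomorphisms are `K`-linearly independent (`K` flat over `ℚ`,
`K ⊗ End_ℚ(V) ⥲ End_K(K ⊗ V)`); universe-general private copy of the tree's `linearIndependent_end_baseChange_of_linearIndependent`.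
[cite: BourbakiAlgebraI1989, Ch. II §5 no. 3 Prop. 7 (ii)] -/
private theorem linearIndependent_baseChange_of_linearIndependent₅₄ {ι : Type*} {a : ι → Module.End ℚ V}
    (ha : LinearIndependent ℚ a) : LinearIndependent K fun i => (a i).baseChange K := by
  haveI : Module.Free ℚ V := Module.Free.of_divisionRing ℚ V
  have h1 : LinearIndependent K fun i => (1 : K) ⊗ₜ[ℚ] a i := Module.Flat.linearIndependent_one_tmul ha
  have j : IsBaseChange K (TensorProduct.isBaseChange ℚ V K).endHom := (TensorProduct.isBaseChange ℚ V K).end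
  have key : ∀ i, j.equiv.symm ((a i).baseChange K) = (1 : K) ⊗ₜ[ℚ] a i := fun i => by
    rw [LinearEquiv.symm_apply_eq, IsBaseChange.equiv_tmul, one_smul, endHom_isBaseChange_eq_baseChange₅₄]
  refine LinearIndependent.of_comp j.equiv.symm.toLinearMap ?_
  convert h1 using 1
  exact funext fun i => by rw [Function.comp_apply, LinearEquiv.coe_coe, key]

/-- **`dim_K span_K {w_K | w ∈ W} = dim_ℚ W` FOR EVERY `ℚ`-SUBSPACE `W ⊆ End_ℚ(V)`** and every field `K ⊇ ℚ`: the base changes of a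
`ℚ`-basis of `W` are `K`-linearly independent (`K ⊗_ℚ End_ℚ(V) ⥲ End_K(K ⊗ V)`, Bourbaki II §5 no. 3 Prop. 7 (ii)) and span the same
`K`-space — the numerical content of «`C'(A) ≅ C(A) ⊗_k k'`» for any rational space of endomorphisms.
[cite: BourbakiAlgebraI1989, Ch. II §5 no. 3 Prop. 7 (ii)] [cite: DeligneMilne1982Tannakian, §1 Prop. 1.9]
[cite: Milne1999LefschetzClasses, §1 Remark 1.6 (p. 644)] -/
theorem finrank_span_image_baseChange_eq (W : Submodule ℚ (Module.End ℚ V)) :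
    Module.finrank K (Submodule.span K ((fun z : Module.End ℚ V => z.baseChange K) '' (W : Set (Module.End ℚ V)))) =
      Module.finrank ℚ W := by
  let b := Module.finBasis ℚ W
  have hb : LinearIndependent ℚ fun i => ((b i : W) : Module.End ℚ V) :=
    b.linearIndependent.map' W.subtype (Submodule.ker_subtype W)
  have hli : LinearIndependent K fun i => ((b i : W) : Module.End ℚ V).baseChange K :=
    linearIndependent_baseChange_of_linearIndependent₅₄ K hb
  have hspan : Submodule.span K ((fun z : Module.End ℚ V => z.baseChange K) '' (W : Set (Module.End ℚ V))) =
      Submodule.span K (Set.range fun i => ((b i : W) : Module.End ℚ V).baseChange K) := by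
    refine le_antisymm (Submodule.span_le.2 ?_) (Submodule.span_mono ?_)
    · rintro _ ⟨w, hw, rfl⟩
      have hw' : w = ∑ i, b.repr ⟨w, hw⟩ i • ((b i : W) : Module.End ℚ V) := by
        have h := congrArg (Subtype.val : W → Module.End ℚ V) (b.sum_repr ⟨w, hw⟩).symm
        rw [AddSubmonoidClass.coe_finsetSum] at h
        simpa only [Submodule.coe_smul] using h
      change w.baseChange K ∈ Submodule.span K (Set.range fun i => ((b i : W) : Module.End ℚ V).baseChange K)
      rw [hw', ← LinearMap.baseChangeHom_apply, map_sum]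
      refine Submodule.sum_mem _ fun i _ => ?_
      rw [map_smul, LinearMap.baseChangeHom_apply]
      exact Submodule.smul_of_tower_mem _ _ (Submodule.subset_span ⟨i, rfl⟩)
    · rintro _ ⟨i, rfl⟩
      exact ⟨_, (b i).2, rfl⟩
  rw [hspan, finrank_span_eq_card hli, Fintype.card_fin]

variable (H : HodgeStructure V n)

set_option maxSynthPendingDepth 4 in
/-- **`dim_K Z(C(H)(K)) = dim_ℚ Z(E_φ)`** — «`Z(C'(A)) = C₀(A) ⊗_k k'`» numerically: the centre of the `K`-points of Milne's
centralizer has the dimension of the centre `C₀` of the endomorphism algebra (g54-#2: `Z(C(H)(K))`, pushed into `End_K(K ⊗ V)`, is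
`span_K {z_K | z ∈ E_φ ∩ C(H)}`; §1; and `E_φ ∩ C(H)` is `Z(E_φ)` pushed into `End_ℚ(V)`).
[cite: Milne1999LefschetzClasses, §1 Remark 1.6 (p. 644) and p. 645 L1–L6] [cite: BourbakiAlgebraI1989, Ch. II §5 no. 3 Prop. 7 (ii)] -/
theorem finrank_center_centralizer_endAlg_baseChange_eq (hH : H.IsPolarizable) :
    Module.finrank K (Subalgebra.center K (Subalgebra.centralizer K
        ((fun a : Module.End ℚ V => a.baseChange K) '' (H.endAlg : Set (Module.End ℚ V))))) =
      Module.finrank ℚ (Subalgebra.center ℚ H.endAlg) := by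
  have hC : Function.Injective (Subalgebra.centralizer K
      ((fun a : Module.End ℚ V => a.baseChange K) '' (H.endAlg : Set (Module.End ℚ V)))).val := Subtype.val_injective
  have hE : Function.Injective H.endAlg.val := Subtype.val_injective
  rw [(Subalgebra.equivMapOfInjective (Subalgebra.center K _) _ hC).toLinearEquiv.finrank_eq,
    (Subalgebra.equivMapOfInjective (Subalgebra.center ℚ H.endAlg) _ hE).toLinearEquiv.finrank_eq,
    ← Subalgebra.finrank_toSubmodule, ← Subalgebra.finrank_toSubmodule (Subalgebra.map _ _),
    toSubmodule_map_val_center_centralizer_endAlg_baseChange_eq_span K H hH,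
    ← Subalgebra.coe_toSubmodule (H.endAlg ⊓ Subalgebra.centralizer ℚ (H.endAlg : Set (Module.End ℚ V))),
    finrank_span_image_baseChange_eq K, map_val_center_endAlg_eq_endAlg_inf_centralizer_endAlg H]

/-! ## §2 `†_K` is trivial on `Z(C(H)(K))` iff `†` is trivial on `Z(E_φ)` -/

variable {H} (ψ : Polarization H)

/-- **`†` TRIVIAL ON `C₀` ⟹ `†_K` TRIVIAL ON `C₀ ⊗ K`**: if the Rosati involution fixes `E_φ ∩ C(H)` pointwise then Milne's `K`-adjoint
`†_K` fixes every `K`-linear combination of the `z_K`, `z ∈ E_φ ∩ C(H)` — `(z_K)^{†_K} = (z†)_K = z_K` (the tree's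
`adjointBaseChange_baseChange`) and `†_K` is `K`-linear. [cite: Milne1999LefschetzClasses, §1 p. 642 L70–L71, Remark 1.6 (p. 644) and p. 645 L1–L6] -/
theorem Polarization.adjointBaseChange_eq_self_of_mem_span_image_center
    (hfix : ∀ z : Module.End ℚ V, z ∈ H.endAlg ⊓ Subalgebra.centralizer ℚ (H.endAlg : Set (Module.End ℚ V)) → ψ.adjoint z = z)
    {x : Module.End K (K ⊗[ℚ] V)}
    (hx : x ∈ Submodule.span K ((fun z : Module.End ℚ V => z.baseChange K) ''
      ((H.endAlg ⊓ Subalgebra.centralizer ℚ (H.endAlg : Set (Module.End ℚ V)) :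
        Subalgebra ℚ (Module.End ℚ V)) : Set (Module.End ℚ V)))) :
    ψ.adjointBaseChange K x = x := by
  have hle : Submodule.span K ((fun z : Module.End ℚ V => z.baseChange K) ''
      ((H.endAlg ⊓ Subalgebra.centralizer ℚ (H.endAlg : Set (Module.End ℚ V)) :
        Subalgebra ℚ (Module.End ℚ V)) : Set (Module.End ℚ V))) ≤
      LinearMap.eqLocus (ψ.adjointBaseChangeLinear K) LinearMap.id := by
    refine Submodule.span_le.2 ?_
    rintro _ ⟨z, hz, rfl⟩
    rw [SetLike.mem_coe, LinearMap.mem_eqLocus, Polarization.adjointBaseChangeLinear_apply, LinearMap.id_apply,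
      ψ.adjointBaseChange_baseChange K, hfix z hz]
  have h := hle hx
  rwa [LinearMap.mem_eqLocus, Polarization.adjointBaseChangeLinear_apply, LinearMap.id_apply] at h

set_option maxSynthPendingDepth 4 in
/-- **`†_K` IS TRIVIAL ON THE CENTRE OF `C(H)(K)` IFF `†` IS TRIVIAL ON THE CENTRE OF `E_φ`** — «of the first kind» does not
depend on the coefficient field (Remark 1.6): `⟸` by the previous statement and `Z(C(H)(K)) = span_K {z_K | z ∈ C₀}` (g54-#2);
`⟹` because `z_K` is central for `z ∈ C₀` and `a ↦ a_K` is injective (`K` faithfully flat over `ℚ`, Mathlib's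
`LinearMap.baseChangeHom_injective`). [cite: Milne1999LefschetzClasses, §1 Remark 1.6 (p. 644), p. 645 L1–L6 and §2 p. 646 L10–L16]
[cite: Lange2023AbelianVarietiesComplex, §2.6.2 Lemma 2.6.4] -/
theorem Polarization.forall_center_adjointBaseChange_eq_self_iff :
    (∀ z : Subalgebra.centralizer K ((fun a : Module.End ℚ V => a.baseChange K) '' (H.endAlg : Set (Module.End ℚ V))),
        z ∈ Subalgebra.center K (Subalgebra.centralizer K
          ((fun a : Module.End ℚ V => a.baseChange K) '' (H.endAlg : Set (Module.End ℚ V)))) →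
          ψ.adjointBaseChange K (z : Module.End K (K ⊗[ℚ] V)) = z) ↔
      ∀ z : H.endAlg, z ∈ Subalgebra.center ℚ H.endAlg → ψ.adjoint (z : Module.End ℚ V) = z := by
  constructor
  · intro h z hz
    -- `z_K` is central in `C(H)(K)` and `†_K`-fixed, so `(z†)_K = z_K`, so `z† = z`
    have hzC : (z : Module.End ℚ V) ∈ Subalgebra.centralizer ℚ (H.endAlg : Set (Module.End ℚ V)) :=
      (mem_center_endAlg_iff_coe_mem_centralizer_endAlg H z).1 hz
    have hzc : (⟨(z : Module.End ℚ V), hzC⟩ : Subalgebra.centralizer ℚ (H.endAlg : Set (Module.End ℚ V))) ∈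
        Subalgebra.center ℚ (Subalgebra.centralizer ℚ (H.endAlg : Set (Module.End ℚ V))) :=
      (mem_center_centralizer_endAlg_iff H ⟨ψ⟩ _).2 z.2
    have hK := h _ (baseChange_mem_center_centralizer_endAlg_baseChange K H ⟨ψ⟩ hzc)
    change ψ.adjointBaseChange K ((z : Module.End ℚ V).baseChange K) = (z : Module.End ℚ V).baseChange K at hK
    rw [ψ.adjointBaseChange_baseChange K] at hK
    haveI : Module.Free ℚ V := Module.Free.of_divisionRing ℚ V
    apply LinearMap.baseChangeHom_injective (R := ℚ) (S := K) (M := V) (N := V)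
    rw [LinearMap.baseChangeHom_apply, LinearMap.baseChangeHom_apply]
    exact hK
  · intro h z hz
    have hx : (z : Module.End K (K ⊗[ℚ] V)) ∈ Submodule.span K ((fun z : Module.End ℚ V => z.baseChange K) ''
        ((H.endAlg ⊓ Subalgebra.centralizer ℚ (H.endAlg : Set (Module.End ℚ V)) :
          Subalgebra ℚ (Module.End ℚ V)) : Set (Module.End ℚ V))) := by
      rw [← toSubmodule_map_val_center_centralizer_endAlg_baseChange_eq_span K H ⟨ψ⟩, Subalgebra.mem_toSubmodule]
      exact ⟨z, hz, rfl⟩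
    refine ψ.adjointBaseChange_eq_self_of_mem_span_image_center K (fun w hw => ?_) hx
    obtain ⟨hwE, hwC⟩ := Algebra.mem_inf.1 hw
    exact h ⟨w, hwE⟩ ((mem_center_endAlg_iff_coe_mem_centralizer_endAlg H ⟨w, hwE⟩).2 hwC)

/-! ## §3 First kind: central elements of `S(H)(K)` are involutions -/

/-- **`†` OF THE FIRST KIND ⟹ EVERY CENTRAL ELEMENT OF `S(A)(K)` IS AN INVOLUTION**, for every field `K ⊇ ℚ`: a central
`γ ∈ S(H)(K)` lies in `C₀ ⊗ K` (g54-#4 `mem_center_lefschetzGroupBaseChange_iff_mem_span_center`), where `†_K` is the identity (§2),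
and `γ^{†_K} γ = 1` (Milne's definition of `S(A)(R)`, the tree's `mem_lefschetzGroupBaseChange_iff_adjointBaseChange_mul_self_eq_one`);
hence `γ² = 1` in `End_K(K ⊗ V)`. [cite: Milne1999LefschetzClasses, §1 p. 644 L16–L24, p. 645 L1–L6 and §2 p. 646 L10–L16]
[cite: Lange2023AbelianVarietiesComplex, §2.6.2 Lemma 2.6.4] -/
theorem Polarization.coe_mul_coe_eq_one_of_mem_center_lefschetzGroupBaseChange
    (hfix : ∀ z : H.endAlg, z ∈ Subalgebra.center ℚ H.endAlg → ψ.adjoint (z : Module.End ℚ V) = z)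
    {γ : ψ.lefschetzGroupBaseChange K} (hγ : γ ∈ Subgroup.center (ψ.lefschetzGroupBaseChange K)) :
    ((γ : (K ⊗[ℚ] V) ≃ₗ[K] (K ⊗[ℚ] V)) : Module.End K (K ⊗[ℚ] V)) *
        ((γ : (K ⊗[ℚ] V) ≃ₗ[K] (K ⊗[ℚ] V)) : Module.End K (K ⊗[ℚ] V)) = 1 := by
  have hU := (((ψ.mem_lefschetzGroupBaseChange_iff_adjointBaseChange_mul_self_eq_one K _).1 γ.2)).2
  have hspan := (ψ.mem_center_lefschetzGroupBaseChange_iff_mem_span_center K γ).1 hγ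
  have hfix' : ∀ z : Module.End ℚ V, z ∈ H.endAlg ⊓ Subalgebra.centralizer ℚ (H.endAlg : Set (Module.End ℚ V)) →
      ψ.adjoint z = z := fun z hz => by
    obtain ⟨hzE, hzC⟩ := Algebra.mem_inf.1 hz
    exact hfix ⟨z, hzE⟩ ((mem_center_endAlg_iff_coe_mem_centralizer_endAlg H ⟨z, hzE⟩).2 hzC)
  rw [ψ.adjointBaseChange_eq_self_of_mem_span_image_center K hfix' hspan] at hU
  exact hU

/-- The same in the group `S(H)(K)`: `γ² = 1`. [cite: Milne1999LefschetzClasses, §1 p. 644 L16–L24, p. 645 L1–L6 and §2 p. 646 L10–L16] -/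
theorem Polarization.mul_self_eq_one_of_mem_center_lefschetzGroupBaseChange
    (hfix : ∀ z : H.endAlg, z ∈ Subalgebra.center ℚ H.endAlg → ψ.adjoint (z : Module.End ℚ V) = z)
    {γ : ψ.lefschetzGroupBaseChange K} (hγ : γ ∈ Subgroup.center (ψ.lefschetzGroupBaseChange K)) : γ * γ = 1 := by
  refine Subtype.ext (LinearEquiv.toLinearMap_injective ?_)
  rw [Subgroup.coe_mul, Subgroup.coe_one, LinearEquiv.coe_toLinearMap_mul, LinearEquiv.coe_toLinearMap_one]
  exact ψ.coe_mul_coe_eq_one_of_mem_center_lefschetzGroupBaseChange K hfix hγ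

end HodgeStructure

end Literature.AlgebraicGeometry.Motives
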